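import Mathlib
import Summits.CriticalPhenomena.SAWScalingLimit.Theses.SAWLeftRightFKG
import Literature.Probability.RandomPlanarGeometry.SAWBridgeUpperBound
import Literature.Probability.RandomPlanarGeometry.SelfAvoidingWalkProofs
import Literature.Topology.PlaneTopology.AnnulusArcs

/-!
# Line `kesten-cone-certificate` — skeleton for crux `LeftRightFKG` (stmt-CriticalPhenomena-11232)

Route `route-CriticalPhenomena-SAWLeftRightFKG`, crux decl
`Summit.CriticalPhenomena.SAWScalingLimit.Theses.SAWLeftRightFKG.LeftRightFKG` (left–right positive
association (PA) of the critical square-lattice SAW chord measure in a simply connected lattice domain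
between boundary-adjacent endpoints). Idea card `Cruxes/LeftRightFKG/Ideas/kesten-cone-certificate.md`
(crux-ideate r1, ideator 2), triage `TRIAGE-r1-2.md` (fail as a self-standing lever, KEEP the Transfer
`KestenConePA` as the hypothesis form of every `x_c`-stub) and `TRIAGE-r1-3.md` (pass; sharpen: first
quantitative test = 2-fold product certificates on boxes); line card `Lines/kesten-cone-certificate.md`.

## The line in one paragraph

DE-TRANSCENDENTALISE `x_c`. The only finite inequalities of `ℤ²` that are sharp at `x_c = 1/μ` are
Kesten's `bₙ x_cⁿ ≤ 1` (`bₙ` = bridges, `SAW.bridgeCount_le_pow`, PROVED in tree). Replace the crux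
(PA at the transcendental point `x_c`) by the TRANSFER `KestenConePA`: for every fugacity `x > 0` and
every `N` with the BRIDGE PRESSURE hypothesis `𝔅_N(x) : bₙ xⁿ ≤ 1 (1 ≤ n ≤ N)`, PA holds at fugacity
`x` on every crux instance all of whose chords have length `≤ N` (`LRPAAtUpTo x N`). `𝔅_N(x_c)` holds
for every `N` (`bridgePressure_criticalFugacity`, PROVED here) and every instance has a chord bound `N`
(`exists_length_le`, PROVED here: `Ω = {wind(C,·) ≠ 0}` is bounded, `meshDomain_finite`), so
`KestenConePA → LeftRightFKG` is PROVED in this file (`leftRightFKG_of_kestenConePA`) — `μ` has left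
the problem: every instance of `KestenConePA` is a finite family of polynomial inequalities over `ℚ[x]`
on the explicit interval `[0, x_b(N)]`, `x_b(N) = min_{n ≤ N} bₙ^{-1/n} ↓ x_c`.

`KestenConePA` is then cut into four registered stubs along the certificate mechanism of the card:

* `stub_cornerReduction : CornerReduction` (L; fugacity-parametric, hereditary): for fixed `(x, N)`,
  corner inequalities `Z(Γ∩A)Z(Γ∩B) ≤ Z(Γ)Z(Γ∩A∩B)` for FIRST-step up-events `A`, LAST-step up-events
  `B` and end-step restrictions `Γ = restr Sa Sb`, on all instances of the class `𝒞_N` (chords `≤ N`),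
  imply full PA at fugacity `x` on `𝒞_N` — the corner-localisation chain (step-rank monotonicity at
  boundary-adjacent endpoints, two-sided domain Markov property, endpoint monotonicity, two-point
  Chebyshev; sibling line `Lines/corner-localisation.lean`, stubs 1–4) run INSIDE `𝒞_N`, which is
  closed under slitting and conditioning on an end step (chord lengths only drop), plus the finite-sum
  dictionary `weightAt x S = ofReal (Zx 𝓣 x S)`. This is where `Adj a a'`/`Adj b b'` are consumed.
* `stub_switchInvolution : SwitchInvolution` (M; fugacity-FREE combinatorics): the corner defect is
  `Σ_nested x^{|α|+|β|} − Σ_crossed x^{|α|+|β|}` (nested: `α ∈ A∩B`, `β ∈ AᶜBᶜ`; crossed: `α ∈ A∖B`,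
  `β ∈ B∖A`). On GOOD pairs (the first interior vertex `p` of `α` on `β` is also the first interior
  vertex of `β` on `α`) the tail switch at `p` is a length-preserving injection crossed-good → nested-good
  (in fact an involution): this cancels, for free and at every `x`, all good pairs.
* `stub_crossedPairsMeet : CrossedPairsMeet` (M/L; planar topology): a crossed pair is never internally
  disjoint (two internally disjoint chords bound a lattice Jordan polygon, hence are `≼`-comparable —
  sibling stub `kesten-loop-towers.stub_comparable` — and comparability contradicts `α ∈ A∖B, β ∈ B∖A`
  for up-sets `A`, `B`).
* `stub_residualCone : ResidualCone` (XL; HARDEST — the whole `x ≤ x_c` content): the RESIDUAL profile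
  `R(X) = Σ_{nested, not good} X^{|α|+|β|} − Σ_{crossed, not good, meeting} X^{|α|+|β|} ∈ ℤ[X]` (internally
  disjoint nested pairs = cores, plus bad nested pairs, minus bad crossed pairs) lies in the KESTEN CONE
  `𝒦_N` := the `ℝ₊[X]`-module generated by all finite products `∏ᵢ (1 − b_{nᵢ} X^{nᵢ})`, `1 ≤ nᵢ ≤ N`
  (`InKestenCone`; Handelman/Krivine monoid — single-bridge (linear) certificates provably cannot be the
  general mechanism: triage LPs kill them at the 9×4 / 8×7-vertex boxes, while 2-fold products restore
  them with margin ≈ 1.5). Combinatorial reading: charge every bad crossed pair to a core through SEVERAL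
  independent bridge extractions (the alternating loop-tower series of `kesten-loop-towers`, priced in
  bridge units) — the `𝔅_N(x)` form of that line's tier (ii), as both triagers asked.

Composition (kernel-checked, no `sorry`): `kestenCone_sound` (PROVED: a cone element is `≥ 0` wherever
`𝔅_N(x)` holds) + the three pair stubs give the corner inequalities on `𝒞_N` under `𝔅_N(x)`
(`corner_ineq_of`, `cornerZxAt_of`: finite-sum algebra `Z(Γ∩A)Z(Γ∩B) ≤ Z(Γ)Z(Γ∩A∩B) ⟺ Σ_crossed ≤
Σ_nested`, good pairs by the injection, meeting bad pairs by the certificate, disjoint crossed pairs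
absent); `stub_cornerReduction` upgrades them to `LRPAAtUpTo x N`, i.e. `KestenConePA`
(`kestenConePA_of`); `leftRightFKG_of_kestenConePA` specialises to `x = x_c` (`weightAt x_c = SAW.weight`
by `rfl`). `LeftRightFKG_of : Registered.stub_cornerReduction → Registered.stub_switchInvolution →
Registered.stub_crossedPairsMeet → Registered.stub_residualCone → LeftRightFKG`.

`Disproof.lean` (cdisprove cycle 1, read 2026-08-16) honoured: (E6)/landed
`Theorems.LeftRightFKG.Negative.leftRightFKG_false_without_boundaryAdjacency` — boundary adjacency is
consumed in `stub_cornerReduction` (step-rank monotonicity; with interior marked points first-step events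
are not up-sets and the reduction is void), all other stubs keep `IsInst`; (E5) `not_leftRightFKGAt`
(PA false for `x ≥ .4495`) — nothing is claimed outside `𝔅_N(x)`, and `{x | 𝔅_N(x)} = (0, x_b(N)]` with
`x_b(47) ≈ .396 < .4495` for the 8×6 box; (tightness) `exists_crossing_pair_cov_eq_zero` — certificates
prove `≥ 0`, never a uniform `ε`, and corner defects vanish identically across cut vertices (`R = 0 ∈ 𝒦`).
Toy check of the two x-free stubs (this seat, `py/goodpairs.py`, exact enumeration, 4×4- and 5×4-vertex
boxes, 33 856 / 952 576 ordered pairs): the switch of every good crossed pair is a pair of SAWs, nested,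
good with the same meeting vertex, same total length; #good-nested = #good-crossed in every degree; no
internally disjoint crossed pair; residual profile = corner profile `(20,−24,−100,−168,−208,−192,−64)` resp.
`(50,−35,−334,−749,−1043,−1120,−767,471,1304,979,300,12,4)` (= the card's and both triagers' profiles).
-/

noncomputable section

open MeasureTheory
open Literature.Probability.LatticeModels Literature.Probability.RandomPlanarGeometry
open Literature.Topology.PlaneTopology
open scoped Classical ENNReal BigOperators

namespace Summit.CriticalPhenomena.SAWScalingLimit.Cruxes.LeftRightFKG.KestenConeCertificate

set_option linter.unusedVariables false

/-! ## 1. Vocabulary — transparent names for the crux's own `let`-terms (as in the sibling lines) -/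

/-- The crux's domain `Ω(C, δ) = {z | wind(δ-polyline of C, z) ≠ 0}`: verbatim the `let Ω` of
`SAWLeftRightFKG.LeftRightFKG`. [folklore] -/
def dom {c : Site 2} (C : (zdGraph 2).Walk c c) (δ : ℝ) : Set ℂ :=
  {z | wind (fun t : ℝ => Set.IccExtend zero_le_one (C.toCurve (meshPoint δ)) t - z) ≠ 0}

/-- The crux's left–right order `γ₁ ≼ γ₂` (lens loop `γ₁ · γ₂⁻¹` has winding `≥ 0` everywhere):
verbatim its `let le`. [folklore] -/
def lr {Ω : Set ℂ} {δ : ℝ} {a b : Site 2} (γ₁ γ₂ : SAW.DomainSAW Ω δ a b) : Prop :=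
  ∀ z : ℂ, 0 ≤ wind
    (fun t : ℝ => Set.IccExtend zero_le_one
      ((γ₁.walk.append γ₂.walk.reverse).toCurve (meshPoint δ)) t - z)

/-- `A` is up-closed for `≼` (the crux's hypothesis on `A`, `B`). [folklore] -/
def IsUp {Ω : Set ℂ} {δ : ℝ} {a b : Site 2} (A : Set (SAW.DomainSAW Ω δ a b)) : Prop :=
  ∀ γ₁ γ₂, lr γ₁ γ₂ → γ₁ ∈ A → γ₂ ∈ A

/-- The first-step vertex `γ(1)` of a chord. [folklore] -/
def firstV {Ω : Set ℂ} {δ : ℝ} {a b : Site 2} (γ : SAW.DomainSAW Ω δ a b) : Site 2 :=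
  γ.walk.getVert 1

/-- The last-step vertex `γ(|γ| - 1)` of a chord. [folklore] -/
def lastV {Ω : Set ℂ} {δ : ℝ} {a b : Site 2} (γ : SAW.DomainSAW Ω δ a b) : Site 2 :=
  γ.walk.reverse.getVert 1

/-- `A` depends only on the first step. [folklore] -/
def FirstDet {Ω : Set ℂ} {δ : ℝ} {a b : Site 2} (A : Set (SAW.DomainSAW Ω δ a b)) : Prop :=
  ∀ γ₁ γ₂, firstV γ₁ = firstV γ₂ → (γ₁ ∈ A ↔ γ₂ ∈ A)

/-- `B` depends only on the last step. [folklore] -/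
def LastDet {Ω : Set ℂ} {δ : ℝ} {a b : Site 2} (B : Set (SAW.DomainSAW Ω δ a b)) : Prop :=
  ∀ γ₁ γ₂, lastV γ₁ = lastV γ₂ → (γ₁ ∈ B ↔ γ₂ ∈ B)

/-- Chords with prescribed first step in `Sa` and last step in `Sb` (the end-step restrictions the
corner-localisation induction produces; `restr univ univ = univ`). [folklore] -/
def restr {Ω : Set ℂ} {δ : ℝ} {a b : Site 2} (Sa Sb : Set (Site 2)) :
    Set (SAW.DomainSAW Ω δ a b) :=
  {γ | firstV γ ∈ Sa ∧ lastV γ ∈ Sb}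

/-- The crux's instance hypotheses: positive mesh, `a'`, `b'` on the boundary walk, `a ∼ a'`,
`b ∼ b'`. [folklore] -/
def IsInst (δ : ℝ) {c : Site 2} (a b a' b' : Site 2) (C : (zdGraph 2).Walk c c) : Prop :=
  0 < δ ∧ a' ∈ C.support ∧ b' ∈ C.support ∧ (zdGraph 2).Adj a a' ∧ (zdGraph 2).Adj b b'

/-! ## 2. The crux at a general fugacity; the bridge-pressure hypothesis; the Transfer -/

/-- The fugacity-`x` chord measure `γ ↦ x^{|γ|}` (same shape as `SAW.weight`, which is the case
`x = x_c` by `rfl`, see the `example`). [folklore] -/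
def weightAt (x : ℝ) (Ω : Set ℂ) (δ : ℝ) (a b : Site 2) : Measure (SAW.DomainSAW Ω δ a b) :=
  Measure.sum fun γ => ENNReal.ofReal (x ^ γ.length) • Measure.dirac γ

/-- The crux's weight is the fugacity-`x_c` instance of `weightAt` — definitionally. [folklore] -/
example (Ω : Set ℂ) (δ : ℝ) (a b : Site 2) :
    SAW.weight Ω δ a b = weightAt SAW.criticalFugacity Ω δ a b := rfl

/-- `LRPAAtUpTo x N`: the crux statement at fugacity `x` (verbatim, over `dom`/`lr`/`IsUp`),
restricted to the HEREDITARY CLASS `𝒞_N` of instances all of whose chords have length `≤ N`. -/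
def LRPAAtUpTo (x : ℝ) (N : ℕ) : Prop :=
  ∀ (δ : ℝ) (c a b a' b' : Site 2) (C : (zdGraph 2).Walk c c), IsInst δ a b a' b' C →
    (∀ γ : SAW.DomainSAW (dom C δ) δ a b, γ.length ≤ N) →
    ∀ A B : Set (SAW.DomainSAW (dom C δ) δ a b), IsUp A → IsUp B →
      weightAt x (dom C δ) δ a b A * weightAt x (dom C δ) δ a b B ≤
        weightAt x (dom C δ) δ a b Set.univ * weightAt x (dom C δ) δ a b (A ∩ B)

/-- BRIDGE PRESSURE `𝔅_N(x)`: `0 < x` and `bₙ xⁿ ≤ 1` for `1 ≤ n ≤ N` (`SAW.bridgeCount n = bₙ`, the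
Walk-bridges of `ℤ²`). Equivalently `x ∈ (0, x_b(N)]`, `x_b(N) = min_{n ≤ N} bₙ^{-1/n}`
(`.577, .523, .4925, .476, .463, …, .4151` for `N = 2 … 18`; `↓ x_c`). [cite: MadrasSlade1993, eq. (1.2.17)] -/
def BridgePressure (x : ℝ) (N : ℕ) : Prop :=
  0 < x ∧ ∀ n : ℕ, 1 ≤ n → n ≤ N → (SAW.bridgeCount n : ℝ) * x ^ n ≤ 1

/-- THE TRANSFER `C⁺` of the card: positive association at EVERY fugacity satisfying the bridge
pressure hypothesis up to the length of the longest chord. -/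
def KestenConePA : Prop :=
  ∀ (x : ℝ) (N : ℕ), BridgePressure x N → LRPAAtUpTo x N

/-- `𝔅_N(x_c)` for every `N`: `bₙ ≤ μⁿ` (tree, PROVED: `SAW.bridgeCount_le_pow`) and `x_c = μ⁻¹ > 0`
(`SAW.criticalFugacity_pos_lt_one'`). [cite: MadrasSlade1993, eq. (1.2.17)] -/
theorem bridgePressure_criticalFugacity (N : ℕ) : BridgePressure SAW.criticalFugacity N := by
  refine ⟨SAW.criticalFugacity_pos_lt_one'.1, fun n _ _ => ?_⟩
  have hμ : 0 < SAW.connectiveConstant := by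
    have := SAW.criticalFugacity_pos_lt_one'.1
    simp only [SAW.criticalFugacity, inv_pos] at this
    exact this
  have hb := SAW.bridgeCount_le_pow n
  have hx : SAW.criticalFugacity ^ n = (SAW.connectiveConstant ^ n)⁻¹ := by
    simp [SAW.criticalFugacity, inv_pow]
  rw [hx]
  have hpos : 0 < SAW.connectiveConstant ^ n := pow_pos hμ n
  calc (SAW.bridgeCount n : ℝ) * (SAW.connectiveConstant ^ n)⁻¹
      ≤ SAW.connectiveConstant ^ n * (SAW.connectiveConstant ^ n)⁻¹ := by gcongr
    _ = 1 := mul_inv_cancel₀ hpos.ne'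

/-! ## 3. Every crux instance lies in some class `𝒞_N` (hence the Transfer implies the crux) -/

/-- Off loops `wind` is the junk value `0`. [folklore] -/
theorem wind_eq_zero_of_ne {f : ℝ → ℂ} (h : f 0 ≠ f 1) : wind f = 0 := by
  rw [wind, dif_neg (fun hh => h hh.2)]

/-- The crux's domain is bounded: a loop does not wind about points farther from `Γ 0` than its
whole range (`wind_sub_eq_zero_of_dist_le`). [folklore] -/
theorem isBounded_dom {c : Site 2} (C : (zdGraph 2).Walk c c) (δ : ℝ) :
    Bornology.IsBounded (dom C δ) := by
  set Γ : ℝ → ℂ := fun t => Set.IccExtend zero_le_one (C.toCurve (meshPoint δ)) t with hΓ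
  by_cases h01 : Γ 0 = Γ 1
  · have hcont : Continuous Γ := (C.toCurve (meshPoint δ)).continuous.Icc_extend'
    have hrange : Set.range Γ = Set.range (C.toCurve (meshPoint δ)) := Set.IccExtend_range _ _
    have hbdd : Bornology.IsBounded (Set.range Γ) := by
      rw [hrange]
      exact (isCompact_range (C.toCurve (meshPoint δ)).continuous).isBounded
    obtain ⟨r, hr⟩ := hbdd.subset_closedBall (Γ 0)
    refine (Metric.isBounded_closedBall (x := Γ 0) (r := r)).subset ?_
    intro z hz
    by_contra hzr
    rw [Metric.mem_closedBall, not_le] at hzr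
    exact hz (wind_sub_eq_zero_of_dist_le hcont.continuousOn h01
      (fun t _ => Metric.mem_closedBall.1 (hr ⟨t, rfl⟩)) hzr)
  · have hempty : dom C δ = ∅ := by
      ext z
      simp only [Set.mem_empty_iff_false, iff_false]
      intro hz
      exact hz (wind_eq_zero_of_ne (fun h => h01 (sub_left_injective h)))
    rw [hempty]
    exact Bornology.isBounded_empty

/-- The vertices of a walk of `Ω_δ` are its initial vertex or vertices of `meshDomain Ω δ`. [folklore] -/
theorem support_subset_of_walk {Ω : Set ℂ} {δ : ℝ} {u v : Site 2}
    (w : (discreteDomainGraph Ω δ).Walk u v) :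
    ∀ z ∈ w.support, z = u ∨ z ∈ meshDomain Ω δ := by
  induction w with
  | nil => intro z hz; left; simpa using hz
  | @cons u' v' w' h p ih =>
    intro z hz
    rw [SimpleGraph.Walk.support_cons, List.mem_cons] at hz
    rcases hz with rfl | hz
    · exact Or.inl rfl
    · right
      rcases ih z hz with rfl | hz'
      · exact (discreteDomainGraph_adj_iff.1 h).2.2
      · exact hz'

/-- CHORD BOUND: for `δ > 0` every crux instance lies in some class `𝒞_N` — a chord is a
duplicate-free list of sites of the finite set `{a} ∪ meshDomain Ω δ` (`meshDomain_finite`,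
`isBounded_dom`). [folklore] -/
theorem exists_length_le {c a b : Site 2} (C : (zdGraph 2).Walk c c) {δ : ℝ} (hδ : 0 < δ) :
    ∃ N : ℕ, ∀ γ : SAW.DomainSAW (dom C δ) δ a b, γ.length ≤ N := by
  have hfin : (insert a (meshDomain (dom C δ) δ)).Finite :=
    (meshDomain_finite (isBounded_dom C δ) hδ).insert a
  refine ⟨hfin.toFinset.card, fun γ => ?_⟩
  have hsub : γ.walk.support.toFinset ⊆ hfin.toFinset := by
    intro z hz
    rw [List.mem_toFinset] at hz
    rw [Set.Finite.mem_toFinset]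
    rcases support_subset_of_walk γ.walk z hz with h | h
    · rw [h]; exact Set.mem_insert _ _
    · exact Set.mem_insert_of_mem _ h
  have hcard := Finset.card_le_card hsub
  rw [List.toFinset_card_of_nodup γ.isPath.support_nodup, SimpleGraph.Walk.length_support] at hcard
  show γ.walk.length ≤ _
  omega

/-- FINITENESS of the chord type of a crux instance (`δ > 0`), for the record (the line's stubs are
stated against an arbitrary enumeration `𝓣`, so the composition does not need it; provers of
`stub_cornerReduction` do). [folklore] -/
theorem finite_domainSAW {c a b : Site 2} (C : (zdGraph 2).Walk c c) {δ : ℝ} (hδ : 0 < δ) :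
    Finite (SAW.DomainSAW (dom C δ) δ a b) := by
  set S : Set (Site 2) := insert a (meshDomain (dom C δ) δ) with hS
  haveI : Finite S := ((meshDomain_finite (isBounded_dom C δ) hδ).insert a).to_subtype
  letI : Fintype S := Fintype.ofFinite S
  have hsupp : ∀ γ : SAW.DomainSAW (dom C δ) δ a b, ∀ z ∈ γ.walk.support, z ∈ S := fun γ z hz => by
    rcases support_subset_of_walk γ.walk z hz with h | h
    · rw [h]; exact Set.mem_insert _ _
    · exact Set.mem_insert_of_mem _ h
  let φ : SAW.DomainSAW (dom C δ) δ a b → List S := fun γ =>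
    γ.walk.support.pmap (fun v hv => ⟨v, hv⟩) (hsupp γ)
  have hφval : ∀ γ, (φ γ).map Subtype.val = γ.walk.support := by
    intro γ
    simp only [φ, List.map_pmap, List.pmap_eq_map, List.map_id']
  have hφinj : Function.Injective φ := by
    intro γ γ' h
    have h' := congrArg (List.map Subtype.val) h
    rw [hφval, hφval] at h'
    have hw : γ.walk = γ'.walk := SimpleGraph.Walk.ext_support h'
    cases γ; cases γ'; cases hw; rfl
  have hφlen : ∀ γ, (φ γ).length ≤ Fintype.card S := fun γ =>
    List.Nodup.length_le_card
      ((γ.isPath.support_nodup).pmap (by intro _ _ _ _ h; exact congrArg Subtype.val h))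
  haveI : Finite {l : List S // l.length ≤ Fintype.card S} :=
    (List.finite_length_le S (Fintype.card S)).to_subtype
  exact Finite.of_injective
    (fun γ => (⟨φ γ, hφlen γ⟩ : {l : List S // l.length ≤ Fintype.card S}))
    fun γ γ' h => hφinj (congrArg Subtype.val h)

/-- `C⁺ ⇒ crux` (PROVED, the card's `leftRightFKG_of_kestenConePA`): take `N :=` a chord bound of the
instance (`exists_length_le`) and `x := x_c` (`bridgePressure_criticalFugacity`); `weightAt x_c` is
`SAW.weight` and `dom C δ`, `lr`, `IsUp` are the crux's `let`-terms, all definitionally. [folklore] -/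
theorem leftRightFKG_of_kestenConePA (h : KestenConePA) :
    Summit.CriticalPhenomena.SAWScalingLimit.Theses.SAWLeftRightFKG.LeftRightFKG := by
  intro δ c a b a' b' C Ω le hδ ha' hb' haa' hbb' A B hA hB
  obtain ⟨N, hN⟩ := exists_length_le C hδ (a := a) (b := b)
  exact h SAW.criticalFugacity N (bridgePressure_criticalFugacity N) δ c a b a' b' C
    ⟨hδ, ha', hb', haa', hbb'⟩ hN A B hA hB

/-! ## 4. Finite sums, pairs of chords, the Kesten cone -/

section Pairs

variable {Ω : Set ℂ} {δ : ℝ} {a b : Site 2}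

/-- `Z_x(S) = Σ_{γ ∈ S} x^{|γ|}` relative to an enumeration `𝓣` of the chords. [folklore] -/
def Zx (𝓣 : Finset (SAW.DomainSAW Ω δ a b)) (x : ℝ) (S : Set (SAW.DomainSAW Ω δ a b)) : ℝ :=
  ∑ γ ∈ 𝓣.filter (· ∈ S), x ^ γ.length

/-- Total length of an ordered pair of chords. [folklore] -/
def pairLen (P : SAW.DomainSAW Ω δ a b × SAW.DomainSAW Ω δ a b) : ℕ :=
  P.1.length + P.2.length

/-- `Z_x` of a set of ordered PAIRS of chords, relative to an enumeration `𝓟` of the pairs. [folklore] -/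
def Zx₂ (𝓟 : Finset (SAW.DomainSAW Ω δ a b × SAW.DomainSAW Ω δ a b)) (x : ℝ)
    (S : Set (SAW.DomainSAW Ω δ a b × SAW.DomainSAW Ω δ a b)) : ℝ :=
  ∑ P ∈ 𝓟.filter (· ∈ S), x ^ pairLen P

/-- The PROFILE POLYNOMIAL `Σ_{P ∈ S} X^{|α|+|β|} ∈ ℝ[X]` of a set of pairs (integer coefficients
`#{P ∈ S : |α|+|β| = k}`). [folklore] -/
def Zpoly₂ (𝓟 : Finset (SAW.DomainSAW Ω δ a b × SAW.DomainSAW Ω δ a b))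
    (S : Set (SAW.DomainSAW Ω δ a b × SAW.DomainSAW Ω δ a b)) : Polynomial ℝ :=
  ∑ P ∈ 𝓟.filter (· ∈ S), (Polynomial.X : Polynomial ℝ) ^ pairLen P

/-- NESTED pairs for (Γ, A, B): `α ∈ Γ ∩ A ∩ B`, `β ∈ Γ ∩ Aᶜ ∩ Bᶜ`. [folklore] -/
def nested (Γ A B : Set (SAW.DomainSAW Ω δ a b)) :
    Set (SAW.DomainSAW Ω δ a b × SAW.DomainSAW Ω δ a b) :=
  {P | P.1 ∈ Γ ∩ A ∩ B ∧ P.2 ∈ Γ ∩ Aᶜ ∩ Bᶜ}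

/-- CROSSED pairs for (Γ, A, B): `α ∈ Γ ∩ A ∩ Bᶜ`, `β ∈ Γ ∩ Aᶜ ∩ B`. [folklore] -/
def crossed (Γ A B : Set (SAW.DomainSAW Ω δ a b)) :
    Set (SAW.DomainSAW Ω δ a b × SAW.DomainSAW Ω δ a b) :=
  {P | P.1 ∈ Γ ∩ A ∩ Bᶜ ∧ P.2 ∈ Γ ∩ Aᶜ ∩ B}

/-- The FIRST MEETING of `α` with `β`: the first vertex of `α` after `a` (in order from `a`), other than
`b`, lying on `β`; `none` iff the two chords are internally disjoint (as in the sibling line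
`kesten-loop-towers`). [folklore] -/
def firstMeet (α β : SAW.DomainSAW Ω δ a b) : Option (Site 2) :=
  α.walk.support.tail.find? fun v => decide (v ≠ b ∧ v ∈ β.walk.support)

/-- GOOD pair: the first meeting of `α` with `β` is also the first meeting of `β` with `α`
(`p = r`). [folklore] -/
def IsGood (α β : SAW.DomainSAW Ω δ a b) : Prop :=
  ∃ p, firstMeet α β = some p ∧ firstMeet β α = some p

/-- The set of good pairs. [folklore] -/
def goodSet : Set (SAW.DomainSAW Ω δ a b × SAW.DomainSAW Ω δ a b) :=
  {P | IsGood P.1 P.2}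

/-- The set of pairs that MEET internally (`firstMeet ≠ none`). [folklore] -/
def meetSet : Set (SAW.DomainSAW Ω δ a b × SAW.DomainSAW Ω δ a b) :=
  {P | firstMeet P.1 P.2 ≠ none}

/-- The RESIDUAL PROFILE of (Γ, A, B) after the free cancellation of good pairs:
`R(X) = Σ_{nested, not good} X^{|α|+|β|} − Σ_{crossed, not good, meeting} X^{|α|+|β|}`. [folklore] -/
def residualPoly (𝓟 : Finset (SAW.DomainSAW Ω δ a b × SAW.DomainSAW Ω δ a b))
    (Γ A B : Set (SAW.DomainSAW Ω δ a b)) : Polynomial ℝ :=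
  Zpoly₂ 𝓟 (nested Γ A B ∩ goodSetᶜ) - Zpoly₂ 𝓟 (crossed Γ A B ∩ goodSetᶜ ∩ meetSet)

end Pairs

/-- A KESTEN GENERATOR PRODUCT `∏_{n ∈ w} (1 − bₙ Xⁿ)` (w a multiset of generator lengths; the empty
product is `1`, the free term). [cite: MadrasSlade1993, eq. (1.2.17)] -/
def kestenGen (w : Multiset ℕ) : Polynomial ℝ :=
  (w.map fun n => (1 - Polynomial.C (SAW.bridgeCount n : ℝ) * Polynomial.X ^ n)).prod

/-- THE KESTEN CONE `𝒦_N`: `P ∈ 𝒦_N` iff `P = Σ_w σ_w · ∏_{n ∈ w}(1 − bₙ Xⁿ)` for finitely many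
multisets `w` of lengths in `[1, N]` and polynomials `σ_w` with NONNEGATIVE coefficients (the
Handelman/Krivine monoid over Kesten's bridge inequalities; `w = 0` carries the free term, singletons
the LINEAR = single-bridge certificates, `card w ≤ k` the `k`-fold ones). [cite: MadrasSlade1993, eq. (1.2.17)] -/
def InKestenCone (N : ℕ) (P : Polynomial ℝ) : Prop :=
  ∃ (W : Finset (Multiset ℕ)) (σ : Multiset ℕ → Polynomial ℝ),
    (∀ w ∈ W, ∀ n ∈ w, 1 ≤ n ∧ n ≤ N) ∧ (∀ w ∈ W, ∀ j : ℕ, 0 ≤ (σ w).coeff j) ∧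
    P = ∑ w ∈ W, σ w * kestenGen w

/-- A polynomial with nonnegative coefficients is nonnegative at `x ≥ 0`. [folklore] -/
theorem eval_nonneg_of_coeff_nonneg {σ : Polynomial ℝ} (hσ : ∀ j, 0 ≤ σ.coeff j) {x : ℝ}
    (hx : 0 ≤ x) : 0 ≤ σ.eval x := by
  rw [Polynomial.eval_eq_sum_range]
  exact Finset.sum_nonneg fun k _ => mul_nonneg (hσ k) (pow_nonneg hx k)

/-- A Kesten generator product is `≥ 0` wherever `𝔅_N(x)` holds. [cite: MadrasSlade1993, eq. (1.2.17)] -/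
theorem eval_kestenGen_nonneg {x : ℝ} {N : ℕ} (hB : BridgePressure x N) {w : Multiset ℕ}
    (hw : ∀ n ∈ w, 1 ≤ n ∧ n ≤ N) : 0 ≤ (kestenGen w).eval x := by
  rw [kestenGen, Polynomial.eval_multiset_prod, Multiset.map_map]
  apply Multiset.prod_nonneg
  intro y hy
  rw [Multiset.mem_map] at hy
  obtain ⟨n, hn, rfl⟩ := hy
  simp only [Function.comp_apply, Polynomial.eval_sub, Polynomial.eval_one, Polynomial.eval_mul,
    Polynomial.eval_C, Polynomial.eval_pow, Polynomial.eval_X, sub_nonneg]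
  exact hB.2 n (hw n hn).1 (hw n hn).2

/-- SOUNDNESS OF KESTEN-CONE CERTIFICATES (PROVED): an element of `𝒦_N` is nonnegative wherever the
bridge pressure hypothesis `𝔅_N(x)` holds — in particular at `x_c`. [cite: MadrasSlade1993, eq. (1.2.17)] -/
theorem kestenCone_sound {x : ℝ} {N : ℕ} {P : Polynomial ℝ} (hB : BridgePressure x N)
    (hP : InKestenCone N P) : 0 ≤ P.eval x := by
  obtain ⟨W, σ, hW, hσ, rfl⟩ := hP
  rw [Polynomial.eval_finsetSum]
  refine Finset.sum_nonneg fun w hw => ?_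
  rw [Polynomial.eval_mul]
  exact mul_nonneg (eval_nonneg_of_coeff_nonneg (hσ w hw) hB.1.le) (eval_kestenGen_nonneg hB (hW w hw))

/-! ### Closure properties of the Kesten cone (API for provers of `stub_residualCone`: certificates add, multiply —
chamber products, case splits — and contain every polynomial with nonnegative coefficients) -/

/-- The empty generator product is `1`. [folklore] -/
theorem kestenGen_zero : kestenGen 0 = 1 := by
  simp [kestenGen]

/-- Generator products multiply along multiset sum. [folklore] -/
theorem kestenGen_add (w w' : Multiset ℕ) : kestenGen (w + w') = kestenGen w * kestenGen w' := by
  simp [kestenGen, Multiset.map_add, Multiset.prod_add]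

/-- A polynomial with nonnegative coefficients lies in every Kesten cone (free term only). [folklore] -/
theorem inKestenCone_of_coeff_nonneg {N : ℕ} {P : Polynomial ℝ} (h : ∀ j, 0 ≤ P.coeff j) :
    InKestenCone N P := by
  refine ⟨{0}, fun _ => P, ?_, fun _ _ j => h j, ?_⟩
  · intro w hw n hn
    rw [Finset.mem_singleton] at hw
    subst hw
    exact absurd hn (Multiset.notMem_zero n)
  · simp [kestenGen_zero]

/-- An admissible generator product lies in the cone. [folklore] -/
theorem inKestenCone_kestenGen {N : ℕ} {w : Multiset ℕ} (hw : ∀ n ∈ w, 1 ≤ n ∧ n ≤ N) :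
    InKestenCone N (kestenGen w) := by
  refine ⟨{w}, fun _ => 1, ?_, ?_, ?_⟩
  · intro w' hw' n hn
    rw [Finset.mem_singleton] at hw'
    subst hw'
    exact hw n hn
  · intro w' _ j
    rw [Polynomial.coeff_one]
    split_ifs <;> norm_num
  · simp

/-- Cones are monotone in the generator bound. [folklore] -/
theorem InKestenCone.mono {N N' : ℕ} (hNN' : N ≤ N') {P : Polynomial ℝ} (h : InKestenCone N P) :
    InKestenCone N' P := by
  obtain ⟨W, σ, hW, hσ, rfl⟩ := h
  exact ⟨W, σ, fun w hw n hn => ⟨(hW w hw n hn).1, (hW w hw n hn).2.trans hNN'⟩, hσ, rfl⟩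

/-- The Kesten cone is closed under addition. [folklore] -/
theorem InKestenCone.add {N : ℕ} {P Q : Polynomial ℝ} (hP : InKestenCone N P) (hQ : InKestenCone N Q) :
    InKestenCone N (P + Q) := by
  obtain ⟨W, σ, hW, hσ, rfl⟩ := hP
  obtain ⟨W', σ', hW', hσ', rfl⟩ := hQ
  refine ⟨W ∪ W', fun w => (if w ∈ W then σ w else 0) + (if w ∈ W' then σ' w else 0), ?_, ?_, ?_⟩
  · intro w hw n hn
    rcases Finset.mem_union.1 hw with h | h
    · exact hW w h n hn
    · exact hW' w h n hn
  · intro w hw j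
    rw [Polynomial.coeff_add]
    apply add_nonneg
    · split_ifs with h
      · exact hσ w h j
      · simp
    · split_ifs with h
      · exact hσ' w h j
      · simp
  · simp only [add_mul, Finset.sum_add_distrib, ite_mul, zero_mul]
    rw [Finset.sum_ite_mem, Finset.sum_ite_mem, Finset.union_inter_cancel_left,
      Finset.union_inter_cancel_right]

/-- The Kesten cone is closed under multiplication (products of certificates certify products — e.g. of
chamber profiles). [folklore] -/
theorem InKestenCone.mul {N : ℕ} {P Q : Polynomial ℝ} (hP : InKestenCone N P) (hQ : InKestenCone N Q) :
    InKestenCone N (P * Q) := by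
  obtain ⟨W, σ, hW, hσ, rfl⟩ := hP
  obtain ⟨W', σ', hW', hσ', rfl⟩ := hQ
  refine ⟨(W ×ˢ W').image (fun p => p.1 + p.2),
    fun u => ∑ p ∈ (W ×ˢ W').filter (fun p => p.1 + p.2 = u), σ p.1 * σ' p.2, ?_, ?_, ?_⟩
  · intro u hu n hn
    obtain ⟨p, hp, rfl⟩ := Finset.mem_image.1 hu
    rw [Finset.mem_product] at hp
    rcases Multiset.mem_add.1 hn with h | h
    · exact hW _ hp.1 n h
    · exact hW' _ hp.2 n h
  · intro u hu j
    rw [Polynomial.finsetSum_coeff]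
    refine Finset.sum_nonneg fun p hp => ?_
    have hp' := Finset.mem_product.1 (Finset.mem_filter.1 hp).1
    rw [Polynomial.coeff_mul]
    exact Finset.sum_nonneg fun ij _ => mul_nonneg (hσ _ hp'.1 _) (hσ' _ hp'.2 _)
  · rw [Finset.sum_mul_sum, ← Finset.sum_product']
    rw [← Finset.sum_fiberwise_of_maps_to (s := W ×ˢ W') (t := (W ×ˢ W').image (fun p => p.1 + p.2))
      (g := fun p => p.1 + p.2) (fun p hp => Finset.mem_image_of_mem _ hp)]
    refine Finset.sum_congr rfl fun u _ => ?_
    rw [Finset.sum_mul]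
    refine Finset.sum_congr rfl fun p hp => ?_
    have hu : p.1 + p.2 = u := (Finset.mem_filter.1 hp).2
    rw [← hu, kestenGen_add]
    ring

/-! ## 5. The four stub statements (named) -/

/-- CORNER INEQUALITIES at fugacity `x` on the class `𝒞_N`, in finite-sum form: for every instance with
chords `≤ N`, every enumeration `𝓣` of its chords, every end-step restriction `Γ = restr Sa Sb` and all
`≼`-up-sets `A` (first-step determined) and `B` (last-step determined):
`Z(Γ ∩ A) · Z(Γ ∩ B) ≤ Z(Γ) · Z(Γ ∩ A ∩ B)`. -/
def CornerZxAt (x : ℝ) (N : ℕ) : Prop :=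
  ∀ (δ : ℝ) (c a b a' b' : Site 2) (C : (zdGraph 2).Walk c c), IsInst δ a b a' b' C →
    (∀ γ : SAW.DomainSAW (dom C δ) δ a b, γ.length ≤ N) →
    ∀ (𝓣 : Finset (SAW.DomainSAW (dom C δ) δ a b)), (∀ γ, γ ∈ 𝓣) →
    ∀ (Sa Sb : Set (Site 2)) (A B : Set (SAW.DomainSAW (dom C δ) δ a b)),
      IsUp A → IsUp B → FirstDet A → LastDet B →
      Zx 𝓣 x (restr Sa Sb ∩ A) * Zx 𝓣 x (restr Sa Sb ∩ B) ≤
        Zx 𝓣 x (restr Sa Sb) * Zx 𝓣 x (restr Sa Sb ∩ A ∩ B)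

/-- STATEMENT OF STUB 1 (L; fugacity-parametric, hereditary): inside each class `𝒞_N`, corner
inequalities at fugacity `x` imply full positive association at fugacity `x`. Intended proof: the
sibling line `corner-localisation` (stubs `stub_stepMonotone`, `stub_domainMarkov`,
`stub_endpointMonotone`, `stub_chebyshev`) run inside `𝒞_N` — closed under zeroing an end step and
under splicing the backtrack `a' → a → a'` into `C` (chord lengths only drop) — plus the dictionary
`weightAt x S = ENNReal.ofReal (Zx 𝓣 x S)` (`finite_domainSAW`). Consumes `Adj a a'`/`Adj b b'`
(step-rank monotonicity; necessary by `leftRightFKG_false_without_boundaryAdjacency`).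
[cite: Harris1960] -/
def CornerReduction : Prop :=
  ∀ (x : ℝ) (N : ℕ), 0 < x → CornerZxAt x N → LRPAAtUpTo x N

/-- STATEMENT OF STUB 2 (M; fugacity-free): the TAIL SWITCH at the common first meeting vertex is a
length-preserving injection from good crossed pairs to good nested pairs (an involution, in fact):
`(α, β) ↦ (α[a,p]·β[p,b], β[a,p]·α[p,b])` — both are SAWs because `p` is the FIRST meeting on both
sides, classes swap because `A` is first-step and `B` last-step determined, `p` stays the common first
meeting. No topology, no fugacity, no adjacency. [folklore] -/
def SwitchInvolution : Prop :=
  ∀ (Ω : Set ℂ) (δ : ℝ) (a b : Site 2) (Sa Sb : Set (Site 2)) (A B : Set (SAW.DomainSAW Ω δ a b)),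
    FirstDet A → LastDet B →
    ∃ ι : {P : SAW.DomainSAW Ω δ a b × SAW.DomainSAW Ω δ a b //
            P ∈ crossed (restr Sa Sb) A B ∧ IsGood P.1 P.2} →
          {Q : SAW.DomainSAW Ω δ a b × SAW.DomainSAW Ω δ a b //
            Q ∈ nested (restr Sa Sb) A B ∧ IsGood Q.1 Q.2},
      Function.Injective ι ∧ ∀ P, pairLen (ι P).1 = pairLen P.1

/-- STATEMENT OF STUB 3 (M/L; planar topology, fugacity-free): on a crux instance a CROSSED pair for
up-sets always meets internally. Two internally disjoint chords of `ℤ²` with common endpoints bound a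
rectilinear Jordan polygon, so their lens has winding of constant sign and they are `≼`-comparable
(sibling stub `kesten-loop-towers.stub_comparable`); `α ≼ β` with `α ∈ A` forces `β ∈ A`, `β ≼ α`
with `β ∈ B` forces `α ∈ B` — either contradicts "crossed". [folklore] -/
def CrossedPairsMeet : Prop :=
  ∀ (δ : ℝ) (c a b a' b' : Site 2) (C : (zdGraph 2).Walk c c), IsInst δ a b a' b' C →
    ∀ (Sa Sb : Set (Site 2)) (A B : Set (SAW.DomainSAW (dom C δ) δ a b)),
      IsUp A → IsUp B → FirstDet A → LastDet B →
      ∀ P ∈ crossed (restr Sa Sb) A B, firstMeet P.1 P.2 ≠ none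

/-- STATEMENT OF STUB 4 (XL; HARDEST — the `x ≤ x_c` content, certificate form of the Transfer at
corners): for every instance of `𝒞_N`, every enumeration, restriction and pair of end-step up-events,
the RESIDUAL PROFILE (cores + bad nested − bad crossed) lies in the Kesten cone `𝒦_N`.
Data (triage r1-2/r1-3, exact-rational LPs on the full corner profile = this residual by stub 2):
LINEAR certificates exist on all boxes up to 8×5 vertices (margins 1.74 … 1.05) and DIE at 9×4 / 8×7
vertices (0.953 / 0.997); 2-fold products restore them (1.45–1.88 up to 10×4 vertices); existence of
SOME product certificate ⟺ strict Transfer on `[0, x_b(N)]` (Krivine), consistent with every measured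
threshold (`x₀(Ω) − x_c ∼ 0.9 L^{-4/3} ≫ x_b(N) − x_c ∼ (log N)/N`). Mechanism to be found: several
independent bridge extractions per bad pair = the loop-tower series of `kesten-loop-towers` priced in
bridge units (renewal structure, Kesten's irreducible bridges). [cite: MadrasSlade1993, eq. (4.2.4)] -/
def ResidualCone : Prop :=
  ∀ (δ : ℝ) (c a b a' b' : Site 2) (C : (zdGraph 2).Walk c c), IsInst δ a b a' b' C →
    ∀ N : ℕ, (∀ γ : SAW.DomainSAW (dom C δ) δ a b, γ.length ≤ N) →
    ∀ (𝓣 : Finset (SAW.DomainSAW (dom C δ) δ a b)), (∀ γ, γ ∈ 𝓣) →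
    ∀ (Sa Sb : Set (Site 2)) (A B : Set (SAW.DomainSAW (dom C δ) δ a b)),
      IsUp A → IsUp B → FirstDet A → LastDet B →
      InKestenCone N (residualPoly (𝓣 ×ˢ 𝓣) (restr Sa Sb) A B)

/-! ## 6. Registered stubs -/

/-- STUB 1 (L): the hereditary corner reduction, see `CornerReduction`. [cite: Harris1960] -/
theorem stub_cornerReduction : CornerReduction := by
  sorry

/-- STUB 2 (M): the switch involution on good pairs, see `SwitchInvolution`. [folklore] -/
theorem stub_switchInvolution : SwitchInvolution := by
  sorry

/-- STUB 3 (M/L): crossed pairs meet, see `CrossedPairsMeet`. [folklore] -/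
theorem stub_crossedPairsMeet : CrossedPairsMeet := by
  sorry

/-- STUB 4 (XL, hardest): Kesten-cone membership of the residual profile, see `ResidualCone`.
[cite: MadrasSlade1993, eq. (4.2.4)] -/
theorem stub_residualCone : ResidualCone := by
  sorry

/-! ## Name-keyed aliases of the four statements (hypotheses of the composition)

`Registered.stub_X` is the statement of `stub_X` under the registered stub's short name, so that the
native skeleton audit (`#h21_check_skeleton`: hypotheses admissible iff registered obligations / declared
stubs BY NAME) accepts `LeftRightFKG_of : Registered.stub_cornerReduction → … → LeftRightFKG` (device of
the sibling skeleton `Lines/corner-localisation.lean`). -/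
namespace Registered

/-- Alias of `CornerReduction` keyed by the registered stub name. [folklore] -/
abbrev stub_cornerReduction : Prop := CornerReduction
/-- Alias of `SwitchInvolution` keyed by the registered stub name. [folklore] -/
abbrev stub_switchInvolution : Prop := SwitchInvolution
/-- Alias of `CrossedPairsMeet` keyed by the registered stub name. [folklore] -/
abbrev stub_crossedPairsMeet : Prop := CrossedPairsMeet
/-- Alias of `ResidualCone` keyed by the registered stub name. [folklore] -/
abbrev stub_residualCone : Prop := ResidualCone

end Registered

/-! ## 7. Composition (kernel-checked, no `sorry`) -/

section Algebra

variable {Ω : Set ℂ} {δ : ℝ} {a b : Site 2}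

/-- Splitting a chord sum along a second set. [folklore] -/
theorem Zx_split (𝓣 : Finset (SAW.DomainSAW Ω δ a b)) (x : ℝ) (S R : Set (SAW.DomainSAW Ω δ a b)) :
    Zx 𝓣 x S = Zx 𝓣 x (S ∩ R) + Zx 𝓣 x (S ∩ Rᶜ) := by
  unfold Zx
  rw [← Finset.sum_filter_add_sum_filter_not (𝓣.filter (· ∈ S)) (· ∈ R)]
  congr 1
  · refine Finset.sum_congr ?_ (fun _ _ => rfl)
    ext γ
    simp only [Finset.mem_filter, Set.mem_inter_iff, and_assoc]
  · refine Finset.sum_congr ?_ (fun _ _ => rfl)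
    ext γ
    simp only [Finset.mem_filter, Set.mem_inter_iff, Set.mem_compl_iff, and_assoc]

/-- Splitting a pair sum along a second set. [folklore] -/
theorem Zx₂_split (𝓟 : Finset (SAW.DomainSAW Ω δ a b × SAW.DomainSAW Ω δ a b)) (x : ℝ)
    (S R : Set (SAW.DomainSAW Ω δ a b × SAW.DomainSAW Ω δ a b)) :
    Zx₂ 𝓟 x S = Zx₂ 𝓟 x (S ∩ R) + Zx₂ 𝓟 x (S ∩ Rᶜ) := by
  unfold Zx₂
  rw [← Finset.sum_filter_add_sum_filter_not (𝓟.filter (· ∈ S)) (· ∈ R)]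
  congr 1
  · refine Finset.sum_congr ?_ (fun _ _ => rfl)
    ext P
    simp only [Finset.mem_filter, Set.mem_inter_iff, and_assoc]
  · refine Finset.sum_congr ?_ (fun _ _ => rfl)
    ext P
    simp only [Finset.mem_filter, Set.mem_inter_iff, Set.mem_compl_iff, and_assoc]

/-- A product of two chord sums is the pair sum over the product set. [folklore] -/
theorem Zx_mul_Zx (𝓣 : Finset (SAW.DomainSAW Ω δ a b)) (x : ℝ) (S R : Set (SAW.DomainSAW Ω δ a b)) :
    Zx 𝓣 x S * Zx 𝓣 x R = Zx₂ (𝓣 ×ˢ 𝓣) x {P | P.1 ∈ S ∧ P.2 ∈ R} := by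
  unfold Zx Zx₂ pairLen
  rw [Finset.sum_mul_sum, ← Finset.sum_product']
  refine Finset.sum_congr ?_ (fun P _ => by rw [pow_add])
  ext P
  simp only [Finset.mem_product, Finset.mem_filter, Set.mem_setOf_eq]
  tauto

/-- The pair sum is the evaluation of the profile polynomial. [folklore] -/
theorem eval_Zpoly₂ (𝓟 : Finset (SAW.DomainSAW Ω δ a b × SAW.DomainSAW Ω δ a b)) (x : ℝ)
    (S : Set (SAW.DomainSAW Ω δ a b × SAW.DomainSAW Ω δ a b)) :
    (Zpoly₂ 𝓟 S).eval x = Zx₂ 𝓟 x S := by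
  simp only [Zpoly₂, Zx₂, Polynomial.eval_finsetSum, Polynomial.eval_pow, Polynomial.eval_X]

/-- Pair sums are dominated along a length-preserving injection between the index sets (stated for
VARIABLE sets `S`, `R` and without `Finset.filter` in the hypotheses, so that no decidability instance
other than the classical one inside `Zx₂` is ever synthesised). [folklore] -/
theorem Zx₂_le_of_inj (𝓟 : Finset (SAW.DomainSAW Ω δ a b × SAW.DomainSAW Ω δ a b)) {x : ℝ}
    (hx : 0 ≤ x) (S R : Set (SAW.DomainSAW Ω δ a b × SAW.DomainSAW Ω δ a b))
    (f : SAW.DomainSAW Ω δ a b × SAW.DomainSAW Ω δ a b → SAW.DomainSAW Ω δ a b × SAW.DomainSAW Ω δ a b)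
    (hmem : ∀ P ∈ 𝓟, P ∈ S → f P ∈ 𝓟 ∧ f P ∈ R)
    (hinj : ∀ P ∈ 𝓟, P ∈ S → ∀ P' ∈ 𝓟, P' ∈ S → f P = f P' → P = P')
    (hlen : ∀ P ∈ 𝓟, P ∈ S → pairLen (f P) = pairLen P) :
    Zx₂ 𝓟 x S ≤ Zx₂ 𝓟 x R := by
  unfold Zx₂
  have hinj' : Set.InjOn f ↑(𝓟.filter (· ∈ S)) := by
    intro P hP P' hP' hPP'
    rw [Finset.mem_coe, Finset.mem_filter] at hP hP'
    exact hinj P hP.1 hP.2 P' hP'.1 hP'.2 hPP'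
  calc ∑ P ∈ 𝓟.filter (· ∈ S), x ^ pairLen P
      = ∑ P ∈ 𝓟.filter (· ∈ S), x ^ pairLen (f P) :=
        Finset.sum_congr rfl fun P hP => by
          rw [Finset.mem_filter] at hP
          rw [hlen P hP.1 hP.2]
    _ = ∑ Q ∈ (𝓟.filter (· ∈ S)).image f, x ^ pairLen Q := by
        rw [Finset.sum_image hinj']
    _ ≤ ∑ Q ∈ 𝓟.filter (· ∈ R), x ^ pairLen Q := by
        apply Finset.sum_le_sum_of_subset_of_nonneg
        · intro Q hQ
          obtain ⟨P, hP, rfl⟩ := Finset.mem_image.1 hQ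
          rw [Finset.mem_filter] at hP ⊢
          exact hmem P hP.1 hP.2
        · intro _ _ _
          exact pow_nonneg hx _

/-- A pair sum over a set containing no enumerated pair vanishes. [folklore] -/
theorem Zx₂_eq_zero_of (𝓟 : Finset (SAW.DomainSAW Ω δ a b × SAW.DomainSAW Ω δ a b)) (x : ℝ)
    (S : Set (SAW.DomainSAW Ω δ a b × SAW.DomainSAW Ω δ a b)) (h : ∀ P ∈ 𝓟, P ∈ S → False) :
    Zx₂ 𝓟 x S = 0 := by
  unfold Zx₂
  refine Finset.sum_eq_zero fun P hP => ?_
  obtain ⟨h1, h2⟩ := Finset.mem_filter.1 hP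
  exact (h P h1 h2).elim

/-- THE CORNER INEQUALITY FROM THE THREE PAIR FACTS (fugacity `x > 0`, arbitrary chord type, sets
`Γ, A, B` and enumeration `𝓣` containing every chord): a length-preserving injection good-crossed →
good-nested, no internally disjoint crossed pair, and `R(x) ≥ 0` for the residual profile give
`Z(Γ∩A) Z(Γ∩B) ≤ Z(Γ) Z(Γ∩A∩B)`. Algebra: with `p, q, r, s` the sums over `Γ∩A∩B`, `Γ∩A∩Bᶜ`,
`Γ∩Aᶜ∩B`, `Γ∩Aᶜ∩Bᶜ` the claim is `(p+q)(p+r) ≤ (p+q+r+s)p ⟺ qr ≤ ps ⟺ Σ_crossed ≤ Σ_nested`.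
[folklore] -/
theorem corner_ineq_of (𝓣 : Finset (SAW.DomainSAW Ω δ a b)) (h𝓣 : ∀ γ, γ ∈ 𝓣) {x : ℝ} (hx : 0 < x)
    (Γ A B : Set (SAW.DomainSAW Ω δ a b))
    (hgood : ∃ ι : {P : SAW.DomainSAW Ω δ a b × SAW.DomainSAW Ω δ a b //
                     P ∈ crossed Γ A B ∧ IsGood P.1 P.2} →
                   {Q : SAW.DomainSAW Ω δ a b × SAW.DomainSAW Ω δ a b //
                     Q ∈ nested Γ A B ∧ IsGood Q.1 Q.2},
               Function.Injective ι ∧ ∀ P, pairLen (ι P).1 = pairLen P.1)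
    (hmeet : ∀ P ∈ crossed Γ A B, firstMeet P.1 P.2 ≠ none)
    (hres : 0 ≤ (residualPoly (𝓣 ×ˢ 𝓣) Γ A B).eval x) :
    Zx 𝓣 x (Γ ∩ A) * Zx 𝓣 x (Γ ∩ B) ≤ Zx 𝓣 x Γ * Zx 𝓣 x (Γ ∩ A ∩ B) := by
  -- the four elementary sums `p, q, r, s` and the three marginals
  have hA' : Zx 𝓣 x (Γ ∩ A) = Zx 𝓣 x (Γ ∩ A ∩ B) + Zx 𝓣 x (Γ ∩ A ∩ Bᶜ) :=
    Zx_split 𝓣 x (Γ ∩ A) B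
  have hB' : Zx 𝓣 x (Γ ∩ B) = Zx 𝓣 x (Γ ∩ A ∩ B) + Zx 𝓣 x (Γ ∩ Aᶜ ∩ B) := by
    rw [Zx_split 𝓣 x (Γ ∩ B) A, Set.inter_right_comm Γ B A, Set.inter_right_comm Γ B Aᶜ]
  have hΓ' : Zx 𝓣 x Γ = (Zx 𝓣 x (Γ ∩ A ∩ B) + Zx 𝓣 x (Γ ∩ A ∩ Bᶜ)) +
      (Zx 𝓣 x (Γ ∩ Aᶜ ∩ B) + Zx 𝓣 x (Γ ∩ Aᶜ ∩ Bᶜ)) := by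
    rw [Zx_split 𝓣 x Γ A, hA', Zx_split 𝓣 x (Γ ∩ Aᶜ) B]
  -- crossed and nested pair sums are the two products `q r` and `p s`
  have hcr : Zx 𝓣 x (Γ ∩ A ∩ Bᶜ) * Zx 𝓣 x (Γ ∩ Aᶜ ∩ B) = Zx₂ (𝓣 ×ˢ 𝓣) x (crossed Γ A B) :=
    Zx_mul_Zx 𝓣 x _ _
  have hne : Zx 𝓣 x (Γ ∩ A ∩ B) * Zx 𝓣 x (Γ ∩ Aᶜ ∩ Bᶜ) = Zx₂ (𝓣 ×ˢ 𝓣) x (nested Γ A B) :=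
    Zx_mul_Zx 𝓣 x _ _
  -- good crossed pairs inject into good nested pairs of the same total length
  have hgood' : Zx₂ (𝓣 ×ˢ 𝓣) x (crossed Γ A B ∩ goodSet) ≤
      Zx₂ (𝓣 ×ˢ 𝓣) x (nested Γ A B ∩ goodSet) := by
    obtain ⟨ι, hιinj, hιlen⟩ := hgood
    let f : SAW.DomainSAW Ω δ a b × SAW.DomainSAW Ω δ a b →
        SAW.DomainSAW Ω δ a b × SAW.DomainSAW Ω δ a b := fun P =>
      if h : P ∈ crossed Γ A B ∧ IsGood P.1 P.2 then (ι ⟨P, h⟩).1 else P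
    have hf : ∀ P (h : P ∈ crossed Γ A B ∧ IsGood P.1 P.2), f P = (ι ⟨P, h⟩).1 :=
      fun P h => dif_pos h
    refine Zx₂_le_of_inj (𝓣 ×ˢ 𝓣) hx.le _ _ f ?_ ?_ ?_
    · intro P _ hPS
      have h : P ∈ crossed Γ A B ∧ IsGood P.1 P.2 := ⟨hPS.1, hPS.2⟩
      rw [hf P h, Finset.mem_product]
      exact ⟨⟨h𝓣 _, h𝓣 _⟩, (ι ⟨P, h⟩).2.1, (ι ⟨P, h⟩).2.2⟩
    · intro P _ hPS P' _ hPS' hPP'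
      have h : P ∈ crossed Γ A B ∧ IsGood P.1 P.2 := ⟨hPS.1, hPS.2⟩
      have h' : P' ∈ crossed Γ A B ∧ IsGood P'.1 P'.2 := ⟨hPS'.1, hPS'.2⟩
      rw [hf P h, hf P' h'] at hPP'
      exact congrArg Subtype.val (hιinj (Subtype.ext hPP'))
    · intro P _ hPS
      have h : P ∈ crossed Γ A B ∧ IsGood P.1 P.2 := ⟨hPS.1, hPS.2⟩
      rw [hf P h, hιlen ⟨P, h⟩]
  -- no crossed pair is internally disjoint
  have hdisj : Zx₂ (𝓣 ×ˢ 𝓣) x (crossed Γ A B ∩ goodSetᶜ ∩ meetSetᶜ) = 0 :=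
    Zx₂_eq_zero_of _ _ _ fun P _ hP => hP.2 (hmeet P hP.1.1)
  -- the residual is the rest
  have hres' : Zx₂ (𝓣 ×ˢ 𝓣) x (crossed Γ A B ∩ goodSetᶜ ∩ meetSet) ≤
      Zx₂ (𝓣 ×ˢ 𝓣) x (nested Γ A B ∩ goodSetᶜ) := by
    have := hres
    rw [residualPoly, Polynomial.eval_sub, eval_Zpoly₂, eval_Zpoly₂] at this
    linarith
  -- assemble: Σ_crossed ≤ Σ_nested, i.e. `q r ≤ p s`
  have hcross_le : Zx 𝓣 x (Γ ∩ A ∩ Bᶜ) * Zx 𝓣 x (Γ ∩ Aᶜ ∩ B) ≤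
      Zx 𝓣 x (Γ ∩ A ∩ B) * Zx 𝓣 x (Γ ∩ Aᶜ ∩ Bᶜ) := by
    rw [hcr, hne, Zx₂_split (𝓣 ×ˢ 𝓣) x (crossed Γ A B) goodSet,
      Zx₂_split (𝓣 ×ˢ 𝓣) x (nested Γ A B) goodSet,
      Zx₂_split (𝓣 ×ˢ 𝓣) x (crossed Γ A B ∩ goodSetᶜ) meetSet, hdisj]
    linarith
  have key : Zx 𝓣 x Γ * Zx 𝓣 x (Γ ∩ A ∩ B) - Zx 𝓣 x (Γ ∩ A) * Zx 𝓣 x (Γ ∩ B) =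
      Zx 𝓣 x (Γ ∩ A ∩ B) * Zx 𝓣 x (Γ ∩ Aᶜ ∩ Bᶜ) -
        Zx 𝓣 x (Γ ∩ A ∩ Bᶜ) * Zx 𝓣 x (Γ ∩ Aᶜ ∩ B) := by
    rw [hA', hB', hΓ']
    ring
  linarith

end Algebra

/-- CORNER INEQUALITIES ON `𝒞_N` UNDER `𝔅_N(x)` from stubs 2–4 and the proved soundness. [folklore] -/
theorem cornerZxAt_of (h₁ : SwitchInvolution) (h₂ : CrossedPairsMeet) (h₃ : ResidualCone)
    {x : ℝ} {N : ℕ} (hB : BridgePressure x N) : CornerZxAt x N := by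
  intro δ c a b a' b' C hI hN 𝓣 h𝓣 Sa Sb A B hAu hBu hAd hBd
  exact corner_ineq_of 𝓣 h𝓣 hB.1 (restr Sa Sb) A B
    (h₁ (dom C δ) δ a b Sa Sb A B hAd hBd)
    (h₂ δ c a b a' b' C hI Sa Sb A B hAu hBu hAd hBd)
    (kestenCone_sound hB (h₃ δ c a b a' b' C hI N hN 𝓣 h𝓣 Sa Sb A B hAu hBu hAd hBd))

/-- THE TRANSFER FROM THE FOUR STUBS: `KestenConePA`. [folklore] -/
theorem kestenConePA_of (h₀ : CornerReduction) (h₁ : SwitchInvolution) (h₂ : CrossedPairsMeet)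
    (h₃ : ResidualCone) : KestenConePA :=
  fun x N hB => h₀ x N hB.1 (cornerZxAt_of h₁ h₂ h₃ hB)

/-- THE LINE: the four stub statements (keyed by the stubs' names) imply the crux BY NAME, through the
Transfer `KestenConePA` and the proved `leftRightFKG_of_kestenConePA`. [folklore] -/
theorem LeftRightFKG_of (h₀ : Registered.stub_cornerReduction) (h₁ : Registered.stub_switchInvolution)
    (h₂ : Registered.stub_crossedPairsMeet) (h₃ : Registered.stub_residualCone) :
    Summit.CriticalPhenomena.SAWScalingLimit.Theses.SAWLeftRightFKG.LeftRightFKG :=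
  leftRightFKG_of_kestenConePA (kestenConePA_of h₀ h₁ h₂ h₃)

/-- WIRING CHECK: the four registered stubs feed `LeftRightFKG_of` as stated (an `example`, so that
`LeftRightFKG_of` stays the only theorem concluding the crux). -/
example : Summit.CriticalPhenomena.SAWScalingLimit.Theses.SAWLeftRightFKG.LeftRightFKG :=
  LeftRightFKG_of stub_cornerReduction stub_switchInvolution stub_crossedPairsMeet stub_residualCone

end Summit.CriticalPhenomena.SAWScalingLimit.Cruxes.LeftRightFKG.KestenConeCertificate

end
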